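import Mathlib
import Summits.NavierStokesRegularity.FluidComputer.GalerkinLevelCeiling
import Summits.NavierStokesRegularity.FluidComputer.TransportGalerkinEmergenceH2
import HarnessLib

/-!
# Galerkin limit of the transport model, XIII: the chain supplies its own `H²` bound — KEEP from the certificates and the Galerkin ODE alone (instab g19, cell `ns-blowup`, 2026-08-27)

HONEST FRAMING (human ruling D-0035): nothing here is a claim about Navier–Stokes blow-up.
WHAT THIS IS NOT: not NS — a MODEL theorem schema about the host-perturbation equation on `𝕋^d`
in the scaled phase space `E = lp (ℤ^d → V) 2`; no number or census word moves.

PURPOSE. Part XI (`TransportGalerkinEmergenceH2.half_prediction_nsField_of_levelBound`) reads KEEP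
without residence but WITH a level-uniform `E`-norm (`H²`) bound `r` on the Galerkin levels of the
seed. THIS FILE REMOVES THAT INPUT TOO: the bound is the bootstrap's own ceiling
`‖u n t‖ ≤ (3/2) ε e^{λt}` at all large levels (`GalerkinLevelCeiling.eventually_norm_le_three_halves`,
from the SAME certificates, eigen data, margin and window as the KEEP word), and the finitely many
small levels are bounded by continuity on the compact window (`exists_levelBound`). Final sentence
(`half_prediction_nsField_of_levels`): KEEP for the model from host data + certificates + eigen/seed
data + margin/window + the Galerkin levels of `ε•v` AS `C¹` SOLUTIONS OF THE FINITE-DIMENSIONAL ODE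
keeping the three linear clauses (existence + linear invariants: classical Picard/energy facts, tree
`Literature.Analysis.ODE.GlobalExistence`) + the regularity class of `w` (uniform polynomial tail).
KERNEL STATE: RESIDENCE (β3), the box, its radii and the `H²` bound are ALL supplied by the chain;
`HOME/instab/BETA2-SPEC.md` §6's engine item is struck.
-/

noncomputable section

open scoped ENNReal NNReal ComplexConjugate InnerProductSpace
open Set Filter Topology

namespace Summit.NavierStokesRegularity.FluidComputer.TransportGalerkinEmergenceLevels

open RCLike
open Literature.Analysis.FunctionSpaces Literature.Analysis.FunctionSpaces.Lattice
open Literature.Analysis.FunctionSpaces.Torus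
open Literature.Analysis.ODE
open Summit.NavierStokesRegularity.FluidComputer.GalerkinLatticePhaseSpace
open Summit.NavierStokesRegularity.FluidComputer.TransportGalerkin
open Summit.NavierStokesRegularity.FluidComputer.TransportGalerkinRapid
open Summit.NavierStokesRegularity.FluidComputer.TransportGalerkinBox
open Summit.NavierStokesRegularity.FluidComputer.TransportGalerkinLevelGenerators
open Summit.NavierStokesRegularity.FluidComputer.TransportGalerkinBilinearLoss
open Summit.NavierStokesRegularity.FluidComputer.GalerkinCertificateTransfer
open Summit.NavierStokesRegularity.FluidComputer.GalerkinLevelCeiling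
open Summit.NavierStokesRegularity.FluidComputer.TransportGalerkinEmergenceH2

variable {d : Type*} [Fintype d] [DecidableEq d]
variable {V : Type*} [NormedAddCommGroup V] [InnerProductSpace ℂ V] [CompleteSpace V] [ProperSpace V]
variable {ν : ℝ} {Uv : (d → ℤ) → V} {π : d → (V →L[ℂ] ℂ)} {P : (d → ℤ) → (V →L[ℂ] V)}

/-! ## §1 The level-uniform `H²` bound from the certificates -/

section LevelBound

omit [ProperSpace V] in
/-- **The chain's own ceiling at all large levels (`eventually_ceiling_nsField`).** For the Galerkin levels `u n` of the seed
`ε•v` (continuous on `[0, T]`, `u n 0 = P_{n+K}(ε v)`, solutions of `y' = P_{n+K} F(y)` with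
CONTINUOUS right-hand side along the trajectory, `P_{n+K}`-fixed), the certificates of record, the
eigen data, the margin `C' > C` and the window condition give ONE `r > 0` with `‖u n t‖ ≤ r` for all
`n` and `t ∈ [0, T]`: the ceiling `(3/2) ε e^{λT}` at all large levels
(`GalerkinLevelCeiling.eventually_norm_le_three_halves` with the transferred certificates, exactly as
in `TransportGalerkinShift.half_prediction_nsField_shift`), continuity on the compact window at the
finitely many others. -/
theorem eventually_ceiling_nsField (K : ℕ) (hUv : RapidDecay Uv) (hπ : ∀ j, ‖π j‖ ≤ 1) (hPn : ∀ k, ‖P k‖ ≤ 1)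
    (hσ : ∑' l : d → ℤ, ENNReal.ofReal (sobolevWeight (-2) l ^ 2) < ∞)
    {T : ℝ}
    {v : lp (fun _ : (d → ℤ) => V) 2} (hv1 : ‖v‖ = 1) {lam ε : ℝ} (hlam : 0 ≤ lam) (hε : 0 < ε)
    {u : ℕ → ℝ → lp (fun _ : (d → ℤ) => V) 2}
    (sol_continuousOn : ∀ n, ContinuousOn (u n) (Icc 0 T))
    (sol_init : ∀ n, u n 0 = cubeProj (n + K) (ε • v))
    (sol_hasDerivWithinAt : ∀ n, ∀ t ∈ Icc 0 T,
      HasDerivWithinAt (u n) (cubeProj (n + K) (nsField ν Uv π P (u n t))) (Icc 0 T) t)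
    (sol_derivCont : ∀ n, ContinuousOn (fun t => cubeProj (n + K) (nsField ν Uv π P (u n t))) (Icc 0 T))
    (sol_proj : ∀ n, ∀ t ∈ Icc 0 T, cubeProj (n + K) (u n t) = u n t)
    {μ : ℝ}
    {G₁ G₂ G : lp (fun _ : (d → ℤ) => V) 2 →L[ℝ] lp (fun _ : (d → ℤ) => V) 2}
    (hG₁ : ∀ x y : lp (fun _ : (d → ℤ) => V) 2, ⟪G₁ x, y⟫_ℂ = ⟪x, G₁ y⟫_ℂ)
    (hG₂ : ∀ x y : lp (fun _ : (d → ℤ) => V) 2, ⟪G₂ x, y⟫_ℂ = ⟪x, G₂ y⟫_ℂ)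
    (hG : ∀ x y : lp (fun _ : (d → ℤ) => V) 2, ⟪G x, y⟫_ℂ = ⟪x, G y⟫_ℂ)
    (hG₁P : ∀ n, ∀ w z : lp (fun _ : (d → ℤ) => V) 2, ⟪G₁ w, cubeProj (n + K) z⟫_ℂ = ⟪G₁ (cubeProj (n + K) w), z⟫_ℂ)
    (hG₂P : ∀ n, ∀ w z : lp (fun _ : (d → ℤ) => V) 2, ⟪G₂ w, cubeProj (n + K) z⟫_ℂ = ⟪G₂ (cubeProj (n + K) w), z⟫_ℂ)
    (hGP : ∀ n, ∀ w z : lp (fun _ : (d → ℤ) => V) 2, ⟪G w, cubeProj (n + K) z⟫_ℂ = ⟪G (cubeProj (n + K) w), z⟫_ℂ)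
    (hG₁pos : ∀ x : lp (fun _ : (d → ℤ) => V) 2, 0 ≤ re ⟪G₁ x, x⟫_ℂ) {ω c m₂ M₁ : ℝ} (hc : 0 < c)
    (hm₂ : 0 < m₂) (hM₁ : 0 ≤ M₁)
    (hm₂' : ∀ x : lp (fun _ : (d → ℤ) => V) 2, m₂ * ‖x‖ ^ 2 ≤ re ⟪G₂ x, x⟫_ℂ)
    (hM₁' : ∀ x : lp (fun _ : (d → ℤ) => V) 2, re ⟪G₁ x, x⟫_ℂ ≤ M₁ * (eNormSq (-1) (⇑x)).toReal)
    {m M ω₁ : ℝ} (hm0 : 0 < m) (hm : ∀ x : lp (fun _ : (d → ℤ) => V) 2, m * ‖x‖ ^ 2 ≤ re ⟪G x, x⟫_ℂ)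
    (hM : ∀ x : lp (fun _ : (d → ℤ) => V) 2, re ⟪G x, x⟫_ℂ ≤ M * ‖x‖ ^ 2)
    (h₁ : ∀ n, ∀ w : lp (fun _ : (d → ℤ) => V) 2,
      2 * re ⟪G₁ (cubeProj (n + K) w), linOp ν Uv π P (cubeProj (n + K) w)⟫_ℂ + c * re ⟪G₂ (cubeProj (n + K) w), cubeProj (n + K) w⟫_ℂ ≤
        2 * ω * re ⟪G₁ (cubeProj (n + K) w), cubeProj (n + K) w⟫_ℂ)
    (h₂ : ∀ n, ∀ w : lp (fun _ : (d → ℤ) => V) 2,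
      re ⟪G₂ (cubeProj (n + K) w), linOp ν Uv π P (cubeProj (n + K) w)⟫_ℂ ≤ ω * re ⟪G₂ (cubeProj (n + K) w), cubeProj (n + K) w⟫_ℂ)
    (hL : ∀ n, ∀ w : lp (fun _ : (d → ℤ) => V) 2,
      re ⟪G (cubeProj (n + K) w), linOp ν Uv π P (cubeProj (n + K) w)⟫_ℂ ≤ ω₁ * re ⟪G (cubeProj (n + K) w), cubeProj (n + K) w⟫_ℂ)
    (hμ₁ : μ ≤ ω₁) (hμ₂ : μ ≤ ω)
    (htail : ∀ n, ∀ q : lp (fun _ : (d → ℤ) => V) 2, cubeProj (n + K) q = 0 →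
      2 * μ * re ⟪G₁ q, q⟫_ℂ + c * re ⟪G₂ q, q⟫_ℂ ≤ 2 * ω * re ⟪G₁ q, q⟫_ℂ)
    (hgap : ω < 2 * lam)
    (hres : Tendsto (fun n => ‖cubeProj (n + K) (linOp ν Uv π P (cubeProj (n + K) v)) - lam • cubeProj (n + K) v‖)
      atTop (𝓝 0))
    {C' : ℝ}
    (hCC' : Real.sqrt (M₁ / (c * m₂)) * (2 * ((Fintype.card d : ℝ) * (2 * Real.pi)) *
        Real.sqrt ((∑' l : d → ℤ, ENNReal.ofReal (sobolevWeight (-2) l ^ 2)).toReal)) * Real.sqrt (Real.pi / (2 * lam - ω)) < C')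
    (hsmall : ∀ t ∈ Icc 0 T, C' * (3 / 2 : ℝ) ^ 2 * (ε * Real.exp (lam * t)) < 3 / 2 - 1) :
    ∀ᶠ n in atTop, ∀ t ∈ Icc 0 T, ‖u n t‖ ≤ 3 / 2 * (ε * Real.exp (lam * t)) := by
  -- the reference weight D = Λ⁻² and the bilinear loss (as in `half_prediction_nsField_shift`)
  obtain ⟨D, hD⟩ := exists_diagWeight (d := d) (V := V)
  have hDP : ∀ n, ∀ w z : lp (fun _ : (d → ℤ) => V) 2,
      ⟪D w, cubeProj (n + K) z⟫_ℂ = ⟪D (cubeProj (n + K) w), z⟫_ℂ := fun n w z => by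
    rw [inner_eq_pairing, inner_eq_pairing, hD, hD, pairing_wmul_neg_two_cubeProj]
  have hDre : ∀ x : lp (fun _ : (d → ℤ) => V) 2, re ⟪D x, x⟫_ℂ = (eNormSq (-1) (⇑x)).toReal := fun x => by
    rw [show re ⟪D x, x⟫_ℂ = (⟪D x, x⟫_ℂ).re from rfl, inner_eq_pairing, hD, re_pairing_wmul_neg_two_self]
  have hDnn : ∀ x : lp (fun _ : (d → ℤ) => V) 2, 0 ≤ re ⟪D x, x⟫_ℂ := fun x => by
    rw [hDre]; exact ENNReal.toReal_nonneg
  have hM₁D : ∀ x : lp (fun _ : (d → ℤ) => V) 2, re ⟪G₁ x, x⟫_ℂ ≤ M₁ * re ⟪D x, x⟫_ℂ := fun x => by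
    rw [hDre]; exact hM₁' x
  have hcalg : 0 ≤ 2 * ((Fintype.card d : ℝ) * (2 * Real.pi)) *
      Real.sqrt ((∑' l : d → ℤ, ENNReal.ofReal (sobolevWeight (-2) l ^ 2)).toReal) := by positivity
  -- the level generators
  obtain ⟨An, hAn⟩ := exists_levelGenerators (ν := ν) (P := P) hUv hπ hPn μ
  have hfix : ∀ n, An (n + K) (cubeProj (n + K) v) = cubeProj (n + K) (linOp ν Uv π P (cubeProj (n + K) v)) :=
    fun n => by rw [hAn, lpProj_idem, sub_self, smul_zero, add_zero]
  have hfield : ∀ n, ∀ w ∈ (Set.univ : Set (lp (fun _ : (d → ℤ) => V) 2)), cubeProj (n + K) w = w →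
      cubeProj (n + K) (nsField ν Uv π P w) = An (n + K) w + cubeProj (n + K) (bilOp π P w w) :=
    fun n => galerkin_field_ext (𝕜 := ℂ) (fun x _ => nsField_eq ν Uv π P x) (hAn (n + K))
  -- classical form of the levels
  have hderiv : ∀ n, ∀ s ∈ Ioo 0 T,
      HasDerivAt (u n) (An (n + K) (u n s) + cubeProj (n + K) (bilOp π P (u n s) (u n s))) s := by
    intro n s hs
    have hsI : s ∈ Icc 0 T := Ioo_subset_Icc_self hs
    have h := (sol_hasDerivWithinAt n s hsI).hasDerivAt (Icc_mem_nhds hs.1 hs.2)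
    rw [hfield n (u n s) (Set.mem_univ _) (sol_proj n s hsI)] at h
    exact h
  have hBu : ∀ n, ContinuousOn (fun s => cubeProj (n + K) (bilOp π P (u n s) (u n s))) (Icc 0 T) := by
    intro n
    have hA : ContinuousOn (fun s => An (n + K) (u n s)) (Icc 0 T) :=
      (An (n + K)).continuous.comp_continuousOn (sol_continuousOn n)
    refine ((sol_derivCont n).sub hA).congr fun s hs => ?_
    show cubeProj (n + K) (bilOp π P (u n s) (u n s)) =
      cubeProj (n + K) (nsField ν Uv π P (u n s)) - An (n + K) (u n s)
    rw [hfield n (u n s) (Set.mem_univ _) (sol_proj n s hs)]; abel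
  -- the data of the abstract ceiling theorem, elaborated one by one
  have hPidem : ∀ n, ∀ w : lp (fun _ : (d → ℤ) => V) 2,
      cubeProj (n + K) (cubeProj (n + K) w) = cubeProj (n + K) w := fun n w => lpProj_idem _ w
  have htend : ∀ w : lp (fun _ : (d → ℤ) => V) 2,
      Tendsto (fun n => cubeProj (n + K) w) atTop (𝓝 w) := fun w =>
    (tendsto_lpProj_cube w).comp (tendsto_add_atTop_nat K)
  have hAn' : ∀ n, ∀ w : lp (fun _ : (d → ℤ) => V) 2,
      An (n + K) w = cubeProj (n + K) (linOp ν Uv π P (cubeProj (n + K) w)) + ((μ : ℂ) • (w - cubeProj (n + K) w)) :=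
    fun n w => hAn (n + K) w
  have hres' : Tendsto (fun n => ‖An (n + K) (cubeProj (n + K) v) - lam • cubeProj (n + K) v‖) atTop (𝓝 0) :=
    hres.congr fun n => by rw [hfix]
  have hB := bilinear_loss hπ hPn hσ hD
  -- the eventual ceiling
  exact eventually_norm_le_three_halves (𝕜 := ℂ) (E := lp (fun _ : (d → ℤ) => V) 2)
    (P := fun n => cubeProj (n + K)) hPidem htend
    (A := linOp ν Uv π P) (B := bilOp π P) (An := fun n => An (n + K)) (μ := μ) hAn'
    (G₁ := G₁) (G₂ := G₂) (D₁ := D) (G := G)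
    hG₁ hG₂ hG hG₁P hG₂P hDP hGP hG₁pos hc hm₂ hM₁ hm₂' hDnn hM₁D hm0 hm hM h₁ h₂ hL hμ₁ hμ₂ htail hcalg
    hB hv1 hgap hlam hε hres' hCC' hsmall sol_continuousOn sol_init hderiv hBu

omit [ProperSpace V] in
/-- **The chain's own `H²` bound, packaged (`exists_levelBound`)**: ONE `r > 0` with `‖u n t‖ ≤ r`
for all levels and all `t ∈ [0, T]` — the ceiling `(3/2) ε e^{λT}` at all large levels
(`eventually_ceiling_nsField`), continuity on the compact window at the finitely many others. -/
theorem exists_levelBound (K : ℕ) (hUv : RapidDecay Uv) (hπ : ∀ j, ‖π j‖ ≤ 1) (hPn : ∀ k, ‖P k‖ ≤ 1)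
    (hσ : ∑' l : d → ℤ, ENNReal.ofReal (sobolevWeight (-2) l ^ 2) < ∞)
    {T : ℝ}
    {v : lp (fun _ : (d → ℤ) => V) 2} (hv1 : ‖v‖ = 1) {lam ε : ℝ} (hlam : 0 ≤ lam) (hε : 0 < ε)
    {u : ℕ → ℝ → lp (fun _ : (d → ℤ) => V) 2}
    (sol_continuousOn : ∀ n, ContinuousOn (u n) (Icc 0 T))
    (sol_init : ∀ n, u n 0 = cubeProj (n + K) (ε • v))
    (sol_hasDerivWithinAt : ∀ n, ∀ t ∈ Icc 0 T,
      HasDerivWithinAt (u n) (cubeProj (n + K) (nsField ν Uv π P (u n t))) (Icc 0 T) t)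
    (sol_derivCont : ∀ n, ContinuousOn (fun t => cubeProj (n + K) (nsField ν Uv π P (u n t))) (Icc 0 T))
    (sol_proj : ∀ n, ∀ t ∈ Icc 0 T, cubeProj (n + K) (u n t) = u n t)
    {μ : ℝ}
    {G₁ G₂ G : lp (fun _ : (d → ℤ) => V) 2 →L[ℝ] lp (fun _ : (d → ℤ) => V) 2}
    (hG₁ : ∀ x y : lp (fun _ : (d → ℤ) => V) 2, ⟪G₁ x, y⟫_ℂ = ⟪x, G₁ y⟫_ℂ)
    (hG₂ : ∀ x y : lp (fun _ : (d → ℤ) => V) 2, ⟪G₂ x, y⟫_ℂ = ⟪x, G₂ y⟫_ℂ)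
    (hG : ∀ x y : lp (fun _ : (d → ℤ) => V) 2, ⟪G x, y⟫_ℂ = ⟪x, G y⟫_ℂ)
    (hG₁P : ∀ n, ∀ w z : lp (fun _ : (d → ℤ) => V) 2, ⟪G₁ w, cubeProj (n + K) z⟫_ℂ = ⟪G₁ (cubeProj (n + K) w), z⟫_ℂ)
    (hG₂P : ∀ n, ∀ w z : lp (fun _ : (d → ℤ) => V) 2, ⟪G₂ w, cubeProj (n + K) z⟫_ℂ = ⟪G₂ (cubeProj (n + K) w), z⟫_ℂ)
    (hGP : ∀ n, ∀ w z : lp (fun _ : (d → ℤ) => V) 2, ⟪G w, cubeProj (n + K) z⟫_ℂ = ⟪G (cubeProj (n + K) w), z⟫_ℂ)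
    (hG₁pos : ∀ x : lp (fun _ : (d → ℤ) => V) 2, 0 ≤ re ⟪G₁ x, x⟫_ℂ) {ω c m₂ M₁ : ℝ} (hc : 0 < c)
    (hm₂ : 0 < m₂) (hM₁ : 0 ≤ M₁)
    (hm₂' : ∀ x : lp (fun _ : (d → ℤ) => V) 2, m₂ * ‖x‖ ^ 2 ≤ re ⟪G₂ x, x⟫_ℂ)
    (hM₁' : ∀ x : lp (fun _ : (d → ℤ) => V) 2, re ⟪G₁ x, x⟫_ℂ ≤ M₁ * (eNormSq (-1) (⇑x)).toReal)
    {m M ω₁ : ℝ} (hm0 : 0 < m) (hm : ∀ x : lp (fun _ : (d → ℤ) => V) 2, m * ‖x‖ ^ 2 ≤ re ⟪G x, x⟫_ℂ)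
    (hM : ∀ x : lp (fun _ : (d → ℤ) => V) 2, re ⟪G x, x⟫_ℂ ≤ M * ‖x‖ ^ 2)
    (h₁ : ∀ n, ∀ w : lp (fun _ : (d → ℤ) => V) 2,
      2 * re ⟪G₁ (cubeProj (n + K) w), linOp ν Uv π P (cubeProj (n + K) w)⟫_ℂ + c * re ⟪G₂ (cubeProj (n + K) w), cubeProj (n + K) w⟫_ℂ ≤
        2 * ω * re ⟪G₁ (cubeProj (n + K) w), cubeProj (n + K) w⟫_ℂ)
    (h₂ : ∀ n, ∀ w : lp (fun _ : (d → ℤ) => V) 2,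
      re ⟪G₂ (cubeProj (n + K) w), linOp ν Uv π P (cubeProj (n + K) w)⟫_ℂ ≤ ω * re ⟪G₂ (cubeProj (n + K) w), cubeProj (n + K) w⟫_ℂ)
    (hL : ∀ n, ∀ w : lp (fun _ : (d → ℤ) => V) 2,
      re ⟪G (cubeProj (n + K) w), linOp ν Uv π P (cubeProj (n + K) w)⟫_ℂ ≤ ω₁ * re ⟪G (cubeProj (n + K) w), cubeProj (n + K) w⟫_ℂ)
    (hμ₁ : μ ≤ ω₁) (hμ₂ : μ ≤ ω)
    (htail : ∀ n, ∀ q : lp (fun _ : (d → ℤ) => V) 2, cubeProj (n + K) q = 0 →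
      2 * μ * re ⟪G₁ q, q⟫_ℂ + c * re ⟪G₂ q, q⟫_ℂ ≤ 2 * ω * re ⟪G₁ q, q⟫_ℂ)
    (hgap : ω < 2 * lam)
    (hres : Tendsto (fun n => ‖cubeProj (n + K) (linOp ν Uv π P (cubeProj (n + K) v)) - lam • cubeProj (n + K) v‖)
      atTop (𝓝 0))
    {C' : ℝ}
    (hCC' : Real.sqrt (M₁ / (c * m₂)) * (2 * ((Fintype.card d : ℝ) * (2 * Real.pi)) *
        Real.sqrt ((∑' l : d → ℤ, ENNReal.ofReal (sobolevWeight (-2) l ^ 2)).toReal)) * Real.sqrt (Real.pi / (2 * lam - ω)) < C')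
    (hsmall : ∀ t ∈ Icc 0 T, C' * (3 / 2 : ℝ) ^ 2 * (ε * Real.exp (lam * t)) < 3 / 2 - 1) :
    ∃ r : ℝ, 0 < r ∧ ∀ n, ∀ t ∈ Icc 0 T, ‖u n t‖ ≤ r := by
  have hev := eventually_ceiling_nsField K hUv hπ hPn hσ hv1 hlam hε sol_continuousOn sol_init
    sol_hasDerivWithinAt sol_derivCont sol_proj hG₁ hG₂ hG hG₁P hG₂P hGP hG₁pos hc hm₂ hM₁ hm₂' hM₁' hm0 hm hM h₁ h₂
    hL hμ₁ hμ₂ htail hgap hres hCC' hsmall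
  obtain ⟨N₀, hN₀⟩ := eventually_atTop.1 hev
  -- the finitely many small levels are bounded by continuity on the compact window
  have hbd : ∀ n, ∃ C, ∀ t ∈ Icc 0 T, ‖u n t‖ ≤ C := fun n =>
    isCompact_Icc.exists_bound_of_continuousOn (sol_continuousOn n)
  choose Cn hCn using hbd
  set r : ℝ := max (max ((Finset.range N₀).sum fun n => |Cn n|) (3 / 2 * (ε * Real.exp (lam * T)))) 1 with hr
  refine ⟨r, lt_of_lt_of_le one_pos (le_max_right _ _), fun n t ht => ?_⟩
  by_cases hn : N₀ ≤ n
  · have h := hN₀ n hn t ht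
    have hexp : Real.exp (lam * t) ≤ Real.exp (lam * T) :=
      Real.exp_le_exp.2 (mul_le_mul_of_nonneg_left ht.2 hlam)
    calc ‖u n t‖ ≤ 3 / 2 * (ε * Real.exp (lam * t)) := h
      _ ≤ 3 / 2 * (ε * Real.exp (lam * T)) := by gcongr
      _ ≤ r := (le_max_right _ _).trans (le_max_left _ _)
  · have hn' : n ∈ Finset.range N₀ := Finset.mem_range.2 (not_le.1 hn)
    calc ‖u n t‖ ≤ Cn n := hCn n t ht
      _ ≤ |Cn n| := le_abs_self _
      _ ≤ (Finset.range N₀).sum fun n => |Cn n| :=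
          Finset.single_le_sum (fun i _ => abs_nonneg (Cn i)) hn'
      _ ≤ r := (le_max_left _ _).trans (le_max_left _ _)

end LevelBound

/-! ## §2 KEEP from the certificates and the Galerkin ODE alone -/

section Keep

/-- **KEEP for the model with residence AND the `H²` bound supplied by the chain**
(`half_prediction_nsField_of_levels`). Hypotheses: host data (`ν > 0`; `Uv` rapidly decreasing,
real, divergence-free through `π`, `‖π_j‖ ≤ 1`; `P` modewise self-adjoint contractions;
`σ₂² = ∑⟨l⟩⁻⁴ < ∞`), the certificate objects and inequalities at levels `≥ K` (verbatim g18), the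
seed `v` (unit, rapidly decreasing, constrained — the X0 door's output) with eigen-consistency, the
margin and window, the Galerkin levels `u n` of `ε•v` as `C¹` solutions of the finite-dimensional
ODE `y' = P_{n+K} F(y)` on `[0, T]` in `range P_{n+K}` keeping the three linear clauses (NO bound
assumed), and the true solution `w` in the class with a uniform polynomial tail of scaled order
`d + 3` and the clauses. Conclusion: `ε e^{λt}/2 ≤ ‖w t‖` while `ε e^{λt} ≤ 2/(9C')`. -/
theorem half_prediction_nsField_of_levels (K : ℕ) (hν : 0 < ν) (hUv : RapidDecay Uv)
    (hUreal : ∀ j p, π j (Uv (-p)) = conj (π j (Uv p)))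
    (hUdiv : ∑ j, freqDeriv j (fun p => π j (Uv p)) = 0) (hπ : ∀ j, ‖π j‖ ≤ 1)
    (hPsa : ∀ k, IsSelfAdjoint (P k)) (hPn : ∀ k, ‖P k‖ ≤ 1)
    (hσ : ∑' l : d → ℤ, ENNReal.ofReal (sobolevWeight (-2) l ^ 2) < ∞)
    {T : ℝ} (hT : 0 ≤ T)
    {v : lp (fun _ : (d → ℤ) => V) 2} (hv1 : ‖v‖ = 1) (hvr : RapidDecay (⇑v))
    (hvfix : ∀ k, P k (v k) = v k) (hvreal : ∀ j k, π j (v (-k)) = conj (π j (v k)))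
    (hvdiv : ∀ k, ∑ j, ((k j : ℤ) : ℂ) * π j (v k) = 0)
    {lam ε : ℝ} (hlam : 0 ≤ lam) (hε : 0 < ε)
    {u : ℕ → ℝ → lp (fun _ : (d → ℤ) => V) 2}
    (sol_continuousOn : ∀ n, ContinuousOn (u n) (Icc 0 T))
    (sol_init : ∀ n, u n 0 = cubeProj (n + K) (ε • v))
    (sol_hasDerivWithinAt : ∀ n, ∀ t ∈ Icc 0 T,
      HasDerivWithinAt (u n) (cubeProj (n + K) (nsField ν Uv π P (u n t))) (Icc 0 T) t)
    (sol_derivCont : ∀ n, ContinuousOn (fun t => cubeProj (n + K) (nsField ν Uv π P (u n t))) (Icc 0 T))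
    (sol_proj : ∀ n, ∀ t ∈ Icc 0 T, cubeProj (n + K) (u n t) = u n t)
    (sol_fix : ∀ n, ∀ t ∈ Icc 0 T, ∀ k, P k ((u n t : (d → ℤ) → V) k) = (u n t : (d → ℤ) → V) k)
    (sol_real : ∀ n, ∀ t ∈ Icc 0 T, ∀ j k,
      π j ((u n t : (d → ℤ) → V) (-k)) = conj (π j ((u n t : (d → ℤ) → V) k)))
    (sol_div : ∀ n, ∀ t ∈ Icc 0 T, ∀ k, ∑ j, ((k j : ℤ) : ℂ) * π j ((u n t : (d → ℤ) → V) k) = 0)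
    {μ : ℝ}
    {G₁ G₂ G : lp (fun _ : (d → ℤ) => V) 2 →L[ℝ] lp (fun _ : (d → ℤ) => V) 2}
    (hG₁ : ∀ x y : lp (fun _ : (d → ℤ) => V) 2, ⟪G₁ x, y⟫_ℂ = ⟪x, G₁ y⟫_ℂ)
    (hG₂ : ∀ x y : lp (fun _ : (d → ℤ) => V) 2, ⟪G₂ x, y⟫_ℂ = ⟪x, G₂ y⟫_ℂ)
    (hG : ∀ x y : lp (fun _ : (d → ℤ) => V) 2, ⟪G x, y⟫_ℂ = ⟪x, G y⟫_ℂ)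
    (hG₁P : ∀ n, ∀ w z : lp (fun _ : (d → ℤ) => V) 2, ⟪G₁ w, cubeProj (n + K) z⟫_ℂ = ⟪G₁ (cubeProj (n + K) w), z⟫_ℂ)
    (hG₂P : ∀ n, ∀ w z : lp (fun _ : (d → ℤ) => V) 2, ⟪G₂ w, cubeProj (n + K) z⟫_ℂ = ⟪G₂ (cubeProj (n + K) w), z⟫_ℂ)
    (hGP : ∀ n, ∀ w z : lp (fun _ : (d → ℤ) => V) 2, ⟪G w, cubeProj (n + K) z⟫_ℂ = ⟪G (cubeProj (n + K) w), z⟫_ℂ)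
    (hG₁pos : ∀ x : lp (fun _ : (d → ℤ) => V) 2, 0 ≤ re ⟪G₁ x, x⟫_ℂ) {ω c m₂ M₁ : ℝ} (hc : 0 < c)
    (hm₂ : 0 < m₂) (hM₁ : 0 ≤ M₁)
    (hm₂' : ∀ x : lp (fun _ : (d → ℤ) => V) 2, m₂ * ‖x‖ ^ 2 ≤ re ⟪G₂ x, x⟫_ℂ)
    (hM₁' : ∀ x : lp (fun _ : (d → ℤ) => V) 2, re ⟪G₁ x, x⟫_ℂ ≤ M₁ * (eNormSq (-1) (⇑x)).toReal)
    {m M ω₁ : ℝ} (hm0 : 0 < m) (hm : ∀ x : lp (fun _ : (d → ℤ) => V) 2, m * ‖x‖ ^ 2 ≤ re ⟪G x, x⟫_ℂ)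
    (hM : ∀ x : lp (fun _ : (d → ℤ) => V) 2, re ⟪G x, x⟫_ℂ ≤ M * ‖x‖ ^ 2)
    (h₁ : ∀ n, ∀ w : lp (fun _ : (d → ℤ) => V) 2,
      2 * re ⟪G₁ (cubeProj (n + K) w), linOp ν Uv π P (cubeProj (n + K) w)⟫_ℂ + c * re ⟪G₂ (cubeProj (n + K) w), cubeProj (n + K) w⟫_ℂ ≤
        2 * ω * re ⟪G₁ (cubeProj (n + K) w), cubeProj (n + K) w⟫_ℂ)
    (h₂ : ∀ n, ∀ w : lp (fun _ : (d → ℤ) => V) 2,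
      re ⟪G₂ (cubeProj (n + K) w), linOp ν Uv π P (cubeProj (n + K) w)⟫_ℂ ≤ ω * re ⟪G₂ (cubeProj (n + K) w), cubeProj (n + K) w⟫_ℂ)
    (hL : ∀ n, ∀ w : lp (fun _ : (d → ℤ) => V) 2,
      re ⟪G (cubeProj (n + K) w), linOp ν Uv π P (cubeProj (n + K) w)⟫_ℂ ≤ ω₁ * re ⟪G (cubeProj (n + K) w), cubeProj (n + K) w⟫_ℂ)
    (hμ₁ : μ ≤ ω₁) (hμ₂ : μ ≤ ω)
    (htail : ∀ n, ∀ q : lp (fun _ : (d → ℤ) => V) 2, cubeProj (n + K) q = 0 →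
      2 * μ * re ⟪G₁ q, q⟫_ℂ + c * re ⟪G₂ q, q⟫_ℂ ≤ 2 * ω * re ⟪G₁ q, q⟫_ℂ)
    (hgap : ω < 2 * lam)
    (hres : Tendsto (fun n => ‖cubeProj (n + K) (linOp ν Uv π P (cubeProj (n + K) v)) - lam • cubeProj (n + K) v‖)
      atTop (𝓝 0))
    {C' : ℝ}
    (hCC' : Real.sqrt (M₁ / (c * m₂)) * (2 * ((Fintype.card d : ℝ) * (2 * Real.pi)) *
        Real.sqrt ((∑' l : d → ℤ, ENNReal.ofReal (sobolevWeight (-2) l ^ 2)).toReal)) * Real.sqrt (Real.pi / (2 * lam - ω)) < C')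
    (hsmall : ∀ t ∈ Icc 0 T, C' * (3 / 2 : ℝ) ^ 2 * (ε * Real.exp (lam * t)) < 3 / 2 - 1)
    {w : ℝ → lp (fun _ : (d → ℤ) => V) 2} (hw : ContinuousOn w (Icc 0 T)) (hw0 : w 0 = ε • v)
    (hw' : ∀ t ∈ Ioo 0 T, HasDerivAt w (nsField ν Uv π P (w t)) t)
    {Cw : ℝ} (hCw : 0 ≤ Cw)
    (hwdec : ∀ t ∈ Icc 0 T, ∀ k, ‖(w t : (d → ℤ) → V) k‖ ≤ Cw * sobolevWeight (-((Fintype.card d : ℝ) + 3)) k)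
    (hwfix : ∀ t ∈ Icc 0 T, ∀ k, P k ((w t : (d → ℤ) → V) k) = (w t : (d → ℤ) → V) k)
    (hwreal : ∀ t ∈ Icc 0 T, ∀ j k, π j ((w t : (d → ℤ) → V) (-k)) = conj (π j ((w t : (d → ℤ) → V) k)))
    (hwdiv : ∀ t ∈ Icc 0 T, ∀ k, ∑ j, ((k j : ℤ) : ℂ) * π j ((w t : (d → ℤ) → V) k) = 0)
    {t : ℝ} (ht : t ∈ Icc 0 T) (hχ : ε * Real.exp (lam * t) ≤ 2 / (9 * C')) :
    ε * Real.exp (lam * t) / 2 ≤ ‖w t‖ := by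
  obtain ⟨r, hr, hbound⟩ := exists_levelBound K hUv hπ hPn hσ hv1 hlam hε sol_continuousOn sol_init
    sol_hasDerivWithinAt sol_derivCont sol_proj hG₁ hG₂ hG hG₁P hG₂P hGP hG₁pos hc hm₂ hM₁ hm₂' hM₁' hm0 hm hM h₁ h₂
    hL hμ₁ hμ₂ htail hgap hres hCC' hsmall
  exact half_prediction_nsField_of_levelBound K hν hUv hUreal hUdiv hπ hPsa hPn hσ hT hv1 hvr hvfix hvreal hvdiv
    hlam hε hr sol_continuousOn sol_init sol_hasDerivWithinAt sol_proj sol_fix sol_real sol_div hbound hG₁ hG₂ hG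
    hG₁P hG₂P hGP hG₁pos hc hm₂ hM₁ hm₂' hM₁' hm0 hm hM h₁ h₂ hL hμ₁ hμ₂ htail hgap hres hCC' hsmall hw hw0 hw'
    hCw hwdec hwfix hwreal hwdiv ht hχ

end Keep

end Summit.NavierStokesRegularity.FluidComputer.TransportGalerkinEmergenceLevels

end
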